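import Mathlib
import HarnessLib

/-!
# Unimodular Hermitian lattices over a discretely valued field with involution: primitive vectors,
# levels, Hensel square roots (O'Meara, *Introduction to Quadratic Forms*, §82; Jacobowitz 1962, §§4–7)

Topic `NumberTheory/Automorphic`; namespace `Literature.NumberTheory.Automorphic.HermitianLattice`.
Definitions (two `Prop`-valued structures) and fully proved lemmas; no named fact, no `sorry`.

**Setting.** `K` a field with a discrete valuation `Valued K ℤᵐ⁰` and valuation ring `𝒪 = 𝒪[K]`;
`σ : K →+* K` an involution preserving the valuation; `ϖ` a `σ`-FIXED uniformiser (the unramified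
situation: e.g. `K = E_w` for a quadratic extension `E/F` of number fields, `w` a place of `E` fixed by the
non-trivial automorphism `c` and unramified over `F`, `σ = c ⊗ 1`, `ϖ ∈ F`); `2 ∈ 𝒪ˣ`; and square roots of
`1`-units exist (Hensel). These hypotheses are bundled in `LocalConjDatum σ ϖ` and discharged for
completions of number fields elsewhere. A `σ`-sesquilinear form is Mathlib's `B : V →ₛₗ[σ] V →ₗ[K] K`
(`B (a • x) y = σ a * B x y`, `B x (a • y) = a * B x y`); it is HERMITIAN when `σ (B x y) = B y x`.

* `IsUnimodularLattice B W L` — `L ≤ V` is a finitely generated `𝒪`-submodule spanning the `K`-subspace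
  `W`, on which `B` is `𝒪`-valued, and which contains every `z ∈ W` with `B(L, z) ⊆ 𝒪` (`L = L^# ∩ W`:
  a unimodular = self-dual lattice in `W`; O'Meara §82F, Jacobowitz §4).
* `exists_apply_eq_one_of_not_mem` — a PRIMITIVE vector `x` of a unimodular lattice (`ϖ⁻¹ x ∉ L`) has a
  partner `y ∈ L` with `B x y = 1` (O'Meara 82:17-type).
* `exists_level` — two lattices in the same space are commensurable: `ϖ^a M ⊆ L` for some `a`; and
  `exists_primitive_of_not_le` — if `M ⊄ L` the least such `a ≥ 1` is attained at some `m ∈ M` with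
  `ϖ^a m ∈ L` primitive.
* `exists_sqrt_fixed` — a `σ`-fixed `1`-unit has a `σ`-fixed square root `s ≡ 1`, with `1 + s ∈ 𝒪ˣ`.
* `IsUnimodularLattice.map_equiv` — transport of unimodularity along a bijective isometry.
* `UnramifiedLocalConjDatum σ ϖ` — the same datum WITHOUT `2 ∈ 𝒪ˣ` and Hensel square roots (dyadic residue
  characteristic allowed), replaced by the two properties of an UNRAMIFIED quadratic extension of local fields
  that the lattice arguments actually use: (trace) `t + σ t = 1` for some integral `t` and (norm)
  «`N(U_L^n) = U_K^n`»: a `σ`-fixed `u ≡ 1` is `z · σ z` with `v (z - 1) ≤ v (u - 1)` (Serre, *Local Fields*, V §2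
  Prop. 3 a); Jacobowitz §7); `LocalConjDatum.toUnramified` (`t = ½`, `z` the `σ`-fixed Hensel root);
  `UnramifiedLocalConjDatum.exists_isotropic_coeff` — the equation `c + α + σ α + q α σ(α) = 0` of the exact
  isotropy step has a solution with `v α ≤ v c`; the lattice lemmas `exists_pow_smul_mem'`, `exists_level'`,
  `exists_apply_eq_one_of_not_mem'`, `exists_primitive_of_not_le'` under the bare hypotheses they use
  (`v ϖ = exp (-1)`, `v ∘ σ = v`), the datum versions being one-line specialisations.

These feed the ADAPTED HYPERBOLIC PLANE of two unimodular lattices (`HermitianLatticesAdaptedPlane`) and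
the Cartan decomposition / symmetric double cosets of hyperspecial unitary groups (cell hodgecm-mathlib,
row IV-9 `HyperspecialGelfandPair`, line `b4-hyperspecial-gelfand-pair`, sub-stubs (2b)/(2L)).

References: O. T. O'Meara, *Introduction to Quadratic Forms* (1963), §82 [Omeara1963];
R. Jacobowitz, *Hermitian forms over local fields*, Amer. J. Math. 84 (1962), §§4–7 [Jacobowitz1962];
J.-P. Serre, *Local Fields*, GTM 67 (1979), Ch. V §2 Prop. 3 [Serre1979].
-/

noncomputable section

open scoped Valued WithZero

namespace Literature.NumberTheory.Automorphic.HermitianLattice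

variable {K : Type*} [Field K]

/-! ## §1 The local data: involution, fixed uniformiser, and either `2 ∈ 𝒪ˣ` + Hensel square roots, or (trace) + (norm) -/

section Datum

variable [Valued K ℤᵐ⁰]

/-- **Local conjugation datum** (the unramified, non-dyadic, henselian situation): `σ` is an involution of
`K` preserving the valuation, `ϖ` is a `σ`-fixed uniformiser (`v ϖ = exp (-1)`), `2` is a unit, and every
`u` with `v (u - 1) < 1` is a square `s²` with `v (s - 1) < 1`. [cite: Omeara1963, §63A (63:1)] -/
structure LocalConjDatum (σ : K →+* K) (ϖ : K) : Prop where
  /-- `σ` is an involution. -/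
  σσ : ∀ x, σ (σ x) = x
  /-- `σ` preserves the valuation. -/
  vσ : ∀ x, Valued.v (σ x) = Valued.v x
  /-- `ϖ` is `σ`-fixed. -/
  σϖ : σ ϖ = ϖ
  /-- `ϖ` is a uniformiser. -/
  vϖ : Valued.v ϖ = WithZero.exp (-1 : ℤ)
  /-- `2` is a unit (non-dyadic). -/
  v2 : Valued.v (2 : K) = 1
  /-- Hensel: `1`-units are squares of `1`-units. -/
  sqrt : ∀ u : K, Valued.v (u - 1) < 1 → ∃ s : K, s ^ 2 = u ∧ Valued.v (s - 1) < 1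

/-- **Unramified local conjugation datum** (every residue characteristic, the dyadic one included): `σ` is an
involution of `K` preserving the valuation, `ϖ` is a `σ`-fixed uniformiser, and the two properties of the
integers of an UNRAMIFIED quadratic extension of local fields hold — (trace) some integral `t` has `t + σ t = 1`
(«the trace is surjective in every separable extension», applied to the residue extension and lifted), and (norm)
«`N(U_L^n) = U_K^n` for all `n ≥ 1`»: every `σ`-fixed `u` with `v (u - 1) < 1` is a norm `z · σ z` with `z - 1` as
small as `u - 1`.  For `K = E_w` at a place `w` of a quadratic extension `E/F` of number fields fixed by the
conjugation and unramified over `F` both hold with no condition on the residue characteristic; the non-dyadic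
datum `LocalConjDatum σ ϖ` implies this one (`LocalConjDatum.toUnramified`).
[cite: Serre1979, Ch. V §2 Prop. 3; Jacobowitz1962, §7] -/
structure UnramifiedLocalConjDatum (σ : K →+* K) (ϖ : K) : Prop where
  /-- `σ` is an involution. -/
  σσ : ∀ x, σ (σ x) = x
  /-- `σ` preserves the valuation. -/
  vσ : ∀ x, Valued.v (σ x) = Valued.v x
  /-- `ϖ` is `σ`-fixed. -/
  σϖ : σ ϖ = ϖ
  /-- `ϖ` is a uniformiser. -/
  vϖ : Valued.v ϖ = WithZero.exp (-1 : ℤ)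
  /-- (trace) the trace `x ↦ x + σ x` takes the value `1` on some integral element. -/
  trace : ∃ t : K, Valued.v t ≤ 1 ∧ t + σ t = 1
  /-- (norm) `N(U^n) = U_σ^n`: a `σ`-fixed `1`-unit `u` is a norm `z σ(z)` with `v (z - 1) ≤ v (u - 1)`. -/
  norm : ∀ u : K, σ u = u → Valued.v (u - 1) < 1 → ∃ z : K, z * σ z = u ∧ Valued.v (z - 1) ≤ Valued.v (u - 1)

/-- Discreteness: `v x < 1 ↔ v x ≤ exp (-1)`. [cite: Omeara1963, Ch. I §11 and §16] -/
theorem v_lt_one_iff (x : K) : Valued.v x < 1 ↔ Valued.v x ≤ WithZero.exp (-1 : ℤ) := by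
  constructor
  · intro h
    by_cases hx : Valued.v x = 0
    · rw [hx]; exact zero_le
    · rw [← WithZero.exp_log hx] at h ⊢
      rw [← WithZero.exp_zero, WithZero.exp_lt_exp] at h
      rw [WithZero.exp_le_exp]
      omega
  · intro h
    exact lt_of_le_of_lt h (by rw [← WithZero.exp_zero, WithZero.exp_lt_exp]; norm_num)

namespace LocalConjDatum

variable {σ : K →+* K} {ϖ : K} (hd : LocalConjDatum σ ϖ)
include hd

/-- `ϖ ≠ 0`. [cite: Omeara1963, Ch. I §16] -/
theorem ϖ_ne_zero : ϖ ≠ 0 := by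
  intro h
  have := hd.vϖ
  rw [h, map_zero] at this
  exact WithZero.coe_ne_zero this.symm

/-- `v (ϖ ^ k) = exp (-k)`. [cite: Omeara1963, Ch. I §16] -/
theorem v_pow (k : ℕ) : Valued.v (ϖ ^ k) = WithZero.exp (-(k : ℤ)) := by
  rw [map_pow, hd.vϖ, ← WithZero.exp_nsmul]
  congr 1
  simp

/-- `v ((ϖ ^ k)⁻¹) = exp k`. [cite: Omeara1963, Ch. I §16] -/
theorem v_pow_inv (k : ℕ) : Valued.v ((ϖ ^ k)⁻¹) = WithZero.exp (k : ℤ) := by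
  rw [map_inv₀, hd.v_pow, ← WithZero.exp_neg, neg_neg]

/-- `v (ϖ ^ k) ≤ 1`. [cite: Omeara1963, Ch. I §16] -/
theorem v_pow_le_one (k : ℕ) : Valued.v (ϖ ^ k) ≤ 1 := by
  rw [hd.v_pow, ← WithZero.exp_zero, WithZero.exp_le_exp]
  omega

/-- `σ (ϖ ^ k) = ϖ ^ k`. [cite: Jacobowitz1962, §2] -/
theorem σ_pow (k : ℕ) : σ (ϖ ^ k) = ϖ ^ k := by
  rw [map_pow, hd.σϖ]

/-- `σ ((ϖ ^ k)⁻¹) = (ϖ ^ k)⁻¹`. [cite: Jacobowitz1962, §2] -/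
theorem σ_pow_inv (k : ℕ) : σ ((ϖ ^ k)⁻¹) = (ϖ ^ k)⁻¹ := by
  rw [map_inv₀, hd.σ_pow]

/-- Every element becomes integral after multiplication by a power of `ϖ`. [cite: Omeara1963, Ch. I §16] -/
theorem exists_pow_mul_le_one (c : K) : ∃ k : ℕ, Valued.v (ϖ ^ k * c) ≤ 1 := by
  by_cases hc : Valued.v c = 0
  · exact ⟨0, by rw [map_mul, hc, mul_zero]; exact zero_le⟩
  · obtain ⟨n, hn⟩ : ∃ n : ℤ, Valued.v c = WithZero.exp n := ⟨_, (WithZero.exp_log hc).symm⟩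
    refine ⟨n.toNat, ?_⟩
    rw [map_mul, hd.v_pow, hn, ← WithZero.exp_add, ← WithZero.exp_zero, WithZero.exp_le_exp]
    omega

omit [Valued K ℤᵐ⁰] hd in
/-- `σ` fixes `2`. [cite: Jacobowitz1962, §2] -/
theorem σ_two : σ 2 = 2 := map_ofNat σ 2

/-- `σ x - 1 = σ (x - 1)`. [cite: Jacobowitz1962, §2] -/
theorem v_σ_sub_one (x : K) : Valued.v (σ x - 1) = Valued.v (x - 1) := by
  have : σ x - 1 = σ (x - 1) := by rw [map_sub, map_one]
  rw [this, hd.vσ]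

/-- **`σ`-fixed Hensel square root.** A `σ`-fixed `u` with `v (u - 1) < 1` has a square root `s` with
`σ s = s`, `v (s - 1) < 1`, `v (1 + s) = 1` (so `1 + s ≠ 0`). Uniqueness of the root `≡ 1`: from
`s² = (σ s)²` we get `(s - σ s)(s + σ s) = 0` and `s + σ s ≡ 2` is a unit. [cite: Omeara1963, §63A (63:1)] -/
theorem exists_sqrt_fixed {u : K} (hu : Valued.v (u - 1) < 1) (hσu : σ u = u) :
    ∃ s : K, s ^ 2 = u ∧ σ s = s ∧ Valued.v (s - 1) < 1 ∧ Valued.v (1 + s) = 1 ∧ 1 + s ≠ 0 := by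
  obtain ⟨s, hs, hs1⟩ := hd.sqrt u hu
  have h2s : Valued.v (1 + s) = 1 := by
    have : (1 + s : K) = 2 + (s - 1) := by ring
    rw [this, Valuation.map_add_eq_of_lt_left _ (by rw [hd.v2]; exact hs1), hd.v2]
  have hsum : Valued.v (s + σ s) = 1 := by
    have : s + σ s = 2 + ((s - 1) + (σ s - 1)) := by ring
    rw [this, Valuation.map_add_eq_of_lt_left _ ?_, hd.v2]
    rw [hd.v2]
    exact Valuation.map_add_lt _ hs1 (by rw [hd.v_σ_sub_one]; exact hs1)
  have hne : s + σ s ≠ 0 := fun h => by rw [h, map_zero] at hsum; exact zero_ne_one hsum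
  have hσs : σ s = s := by
    have hprod : (s - σ s) * (s + σ s) = 0 := by
      have : (σ s) ^ 2 = u := by rw [← map_pow, hs, hσu]
      linear_combination hs - this
    rcases mul_eq_zero.1 hprod with h | h
    · exact (sub_eq_zero.1 h).symm
    · exact absurd h hne
  refine ⟨s, hs, hσs, hs1, h2s, fun h => ?_⟩
  rw [h, map_zero] at h2s
  exact zero_ne_one h2s

/-- **The non-dyadic datum is an unramified datum**: (trace) holds with `t = ½`, and (norm) with `z` the `σ`-fixed
Hensel square root `s` of `u` (`s · σ s = s² = u`, and `v (s - 1) = v (u - 1)` because `u - 1 = (s - 1)(1 + s)` with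
`1 + s` a unit). [cite: Serre1979, Ch. V §2 Prop. 3; Omeara1963, §63A (63:1)] -/
theorem toUnramified : UnramifiedLocalConjDatum σ ϖ := by
  have h20 : (2 : K) ≠ 0 := fun h => by
    have := hd.v2
    rw [h, map_zero] at this
    exact zero_ne_one this
  refine ⟨hd.σσ, hd.vσ, hd.σϖ, hd.vϖ, ⟨2⁻¹, ?_, ?_⟩, fun u hσu hu => ?_⟩
  · rw [map_inv₀, hd.v2, inv_one]
  · rw [map_inv₀, map_ofNat, ← two_mul, mul_inv_cancel₀ h20]
  · obtain ⟨s, hs, hσs, -, h1s, -⟩ := hd.exists_sqrt_fixed hu hσu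
    refine ⟨s, by rw [hσs, ← sq, hs], le_of_eq ?_⟩
    rw [show u - 1 = (s - 1) * (1 + s) by rw [← hs]; ring, map_mul, h1s, mul_one]

end LocalConjDatum

namespace UnramifiedLocalConjDatum

variable {σ : K →+* K} {ϖ : K} (hd : UnramifiedLocalConjDatum σ ϖ)
include hd

/-- `ϖ ≠ 0`. [cite: Omeara1963, Ch. I §16] -/
theorem ϖ_ne_zero : ϖ ≠ 0 := by
  intro h
  have := hd.vϖ
  rw [h, map_zero] at this
  exact WithZero.coe_ne_zero this.symm

/-- `v (ϖ ^ k) = exp (-k)`. [cite: Omeara1963, Ch. I §16] -/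
theorem v_pow (k : ℕ) : Valued.v (ϖ ^ k) = WithZero.exp (-(k : ℤ)) := by
  rw [map_pow, hd.vϖ, ← WithZero.exp_nsmul]
  congr 1
  simp

/-- `v ((ϖ ^ k)⁻¹) = exp k`. [cite: Omeara1963, Ch. I §16] -/
theorem v_pow_inv (k : ℕ) : Valued.v ((ϖ ^ k)⁻¹) = WithZero.exp (k : ℤ) := by
  rw [map_inv₀, hd.v_pow, ← WithZero.exp_neg, neg_neg]

/-- `v (ϖ ^ k) ≤ 1`. [cite: Omeara1963, Ch. I §16] -/
theorem v_pow_le_one (k : ℕ) : Valued.v (ϖ ^ k) ≤ 1 := by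
  rw [hd.v_pow, ← WithZero.exp_zero, WithZero.exp_le_exp]
  omega

/-- `σ (ϖ ^ k) = ϖ ^ k`. [cite: Jacobowitz1962, §2] -/
theorem σ_pow (k : ℕ) : σ (ϖ ^ k) = ϖ ^ k := by
  rw [map_pow, hd.σϖ]

/-- `σ ((ϖ ^ k)⁻¹) = (ϖ ^ k)⁻¹`. [cite: Jacobowitz1962, §2] -/
theorem σ_pow_inv (k : ℕ) : σ ((ϖ ^ k)⁻¹) = (ϖ ^ k)⁻¹ := by
  rw [map_inv₀, hd.σ_pow]

/-- Every element becomes integral after multiplication by a power of `ϖ`. [cite: Omeara1963, Ch. I §16] -/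
theorem exists_pow_mul_le_one (c : K) : ∃ k : ℕ, Valued.v (ϖ ^ k * c) ≤ 1 := by
  by_cases hc : Valued.v c = 0
  · exact ⟨0, by rw [map_mul, hc, mul_zero]; exact zero_le⟩
  · obtain ⟨n, hn⟩ : ∃ n : ℤ, Valued.v c = WithZero.exp n := ⟨_, (WithZero.exp_log hc).symm⟩
    refine ⟨n.toNat, ?_⟩
    rw [map_mul, hd.v_pow, hn, ← WithZero.exp_add, ← WithZero.exp_zero, WithZero.exp_le_exp]
    omega

/-- `σ x - 1 = σ (x - 1)`. [cite: Jacobowitz1962, §2] -/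
theorem v_σ_sub_one (x : K) : Valued.v (σ x - 1) = Valued.v (x - 1) := by
  have : σ x - 1 = σ (x - 1) := by rw [map_sub, map_one]
  rw [this, hd.vσ]

/-- **The isotropy equation without `2`.**  For `σ`-fixed `c`, `q` with `q` integral and `v c < 1` the equation
`c + α + σ α + q · α σ(α) = 0` — exact isotropy of `x₀ + α y₀` when `B x₀ x₀ = c`, `B x₀ y₀ = 1`, `B y₀ y₀ = q` — has a
solution with `v α ≤ v c`: for `q = 0` take `α = -c t` with the trace element `t`; for `q ≠ 0` the equation says
`(1 + q α) σ(1 + q α) = 1 - q c`, and `1 - q c` is a `σ`-fixed `1`-unit, hence a norm `z σ(z)` with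
`v (z - 1) ≤ v (q c)` by (norm); take `α = (z - 1)/q`.  (This replaces the Hensel square root `s² = 1 - c q`,
`α = -c/(1 + s)` of the non-dyadic argument; Jacobowitz §7 treats the unramified dyadic case the same way.)
[cite: Jacobowitz1962, §7; Serre1979, Ch. V §2 Prop. 3] -/
theorem exists_isotropic_coeff {c q : K} (hσc : σ c = c) (hσq : σ q = q) (hvq : Valued.v q ≤ 1)
    (hvc : Valued.v c < 1) : ∃ α : K, Valued.v α ≤ Valued.v c ∧ c + α + σ α + q * (α * σ α) = 0 := by
  by_cases hq : q = 0
  · obtain ⟨t, ht1, htt⟩ := hd.trace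
    refine ⟨-(c * t), ?_, ?_⟩
    · rw [Valuation.map_neg, map_mul]
      calc Valued.v c * Valued.v t ≤ Valued.v c * 1 := mul_le_mul' le_rfl ht1
        _ = Valued.v c := mul_one _
    · rw [hq, zero_mul, add_zero, map_neg, map_mul, hσc]
      linear_combination (-c) * htt
  · have hσu : σ (1 - q * c) = 1 - q * c := by rw [map_sub, map_one, map_mul, hσq, hσc]
    have hvqc : Valued.v (q * c) < 1 := by
      rw [map_mul]
      calc Valued.v q * Valued.v c ≤ 1 * Valued.v c := mul_le_mul' hvq le_rfl
        _ < 1 := by rw [one_mul]; exact hvc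
    have hu1 : Valued.v ((1 - q * c) - 1) < 1 := by
      rw [show (1 - q * c) - 1 = -(q * c) by ring, Valuation.map_neg]
      exact hvqc
    obtain ⟨z, hz, hz1⟩ := hd.norm _ hσu hu1
    rw [show (1 - q * c) - 1 = -(q * c) by ring, Valuation.map_neg, map_mul] at hz1
    have hvq0 : Valued.v q ≠ 0 := (Valuation.ne_zero_iff _).2 hq
    refine ⟨(z - 1) / q, ?_, ?_⟩
    · rw [map_div₀, div_le_iff₀ (zero_lt_iff.2 hvq0), mul_comm]
      exact hz1
    · have hσα : σ ((z - 1) / q) = (σ z - 1) / q := by rw [map_div₀, map_sub, map_one, hσq]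
      rw [hσα]
      field_simp
      linear_combination hz

end UnramifiedLocalConjDatum

end Datum

/-! ## §2 Hermitian forms -/

section Form

variable {V : Type*} [AddCommGroup V] [Module K V] {σ : K →+* K}

/-- `B` is `σ`-Hermitian: `σ (B x y) = B y x`. [cite: Jacobowitz1962, §1] -/
def IsHermitianForm (B : V →ₛₗ[σ] V →ₗ[K] K) : Prop := ∀ x y, σ (B x y) = B y x

variable (B : V →ₛₗ[σ] V →ₗ[K] K)

/-- `B (a • x) y = σ a * B x y`. [cite: Jacobowitz1962, §1] -/
theorem form_smul_left (a : K) (x y : V) : B (a • x) y = σ a * B x y := by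
  rw [LinearMap.map_smulₛₗ, LinearMap.smul_apply, smul_eq_mul]

/-- `B x (a • y) = a * B x y`. [cite: Jacobowitz1962, §1] -/
theorem form_smul_right (a : K) (x y : V) : B x (a • y) = a * B x y := by
  rw [LinearMap.map_smul, smul_eq_mul]

/-- `B (a • x) y` for `a ∈ 𝒪`. [cite: Jacobowitz1962, §1] -/
theorem form_smul_left_int [Valued K ℤᵐ⁰] (a : 𝒪[K]) (x y : V) : B (a • x) y = σ a * B x y :=
  form_smul_left B a x y

/-- `B x (a • y)` for `a ∈ 𝒪`. [cite: Jacobowitz1962, §1] -/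
theorem form_smul_right_int [Valued K ℤᵐ⁰] (a : 𝒪[K]) (x y : V) : B x (a • y) = (a : K) * B x y :=
  form_smul_right B a x y

variable {B}

namespace IsHermitianForm

variable (hB : IsHermitianForm B)
include hB

/-- `B x x` is `σ`-fixed. [cite: Jacobowitz1962, §1] -/
theorem apply_self (x : V) : σ (B x x) = B x x := hB x x

/-- `B x y = 0 ↔ B y x = 0`. [cite: Jacobowitz1962, §1] -/
theorem eq_zero_comm {x y : V} : B x y = 0 ↔ B y x = 0 := by
  constructor
  · intro h; rw [← hB x y, h, map_zero]
  · intro h; rw [← hB y x, h, map_zero]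

/-- `B x y = 1 → B y x = 1`. [cite: Jacobowitz1962, §1] -/
theorem eq_one_comm {x y : V} (h : B x y = 1) : B y x = 1 := by
  rw [← hB x y, h, map_one]

/-- With a valuation-preserving `σ`: `v (B y x) = v (B x y)`. [cite: Jacobowitz1962, §2] -/
theorem v_comm [Valued K ℤᵐ⁰] (hvσ : ∀ a, Valued.v (σ a) = Valued.v a) (x y : V) :
    Valued.v (B y x) = Valued.v (B x y) := by
  rw [← hB x y, hvσ]

end IsHermitianForm

end Form

/-! ## §3 Unimodular lattices -/

section Lattice

variable [Valued K ℤᵐ⁰] {V : Type*} [AddCommGroup V] [Module K V] {σ : K →+* K} {ϖ : K}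

/-- Membership in `𝒪[K]` is `v ≤ 1`. [cite: Omeara1963, Ch. I §13] -/
theorem mem_integer_iff' (a : K) : a ∈ 𝒪[K] ↔ Valued.v a ≤ 1 := Valuation.mem_integer_iff _ _

/-- An integral scalar acts on an `𝒪`-submodule. [cite: Omeara1963, §81A] -/
theorem smul_mem_of_v_le (L : Submodule 𝒪[K] V) {a : K} (ha : Valued.v a ≤ 1) {x : V} (hx : x ∈ L) :
    a • x ∈ L :=
  L.smul_mem (⟨a, (mem_integer_iff' a).2 ha⟩ : 𝒪[K]) hx

/-- **Unimodular (self-dual) lattice in the subspace `W`** for the form `B`: a finitely generated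
`𝒪`-submodule `L` spanning `W` over `K`, with `B(L, L) ⊆ 𝒪`, and maximal for this: every `z ∈ W` with
`B(L, z) ⊆ 𝒪` lies in `L` (i.e. `L = L^# ∩ W`). [cite: Omeara1963, §82F] -/
structure IsUnimodularLattice (B : V →ₛₗ[σ] V →ₗ[K] K) (W : Submodule K V) (L : Submodule 𝒪[K] V) :
    Prop where
  /-- finitely generated -/
  fg : L.FG
  /-- spans `W` -/
  span_eq : Submodule.span K (L : Set V) = W
  /-- `B` is integral on `L` -/
  integral : ∀ x ∈ L, ∀ y ∈ L, Valued.v (B x y) ≤ 1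
  /-- self-duality inside `W` -/
  dual : ∀ z ∈ W, (∀ x ∈ L, Valued.v (B x z) ≤ 1) → z ∈ L

namespace IsUnimodularLattice

variable {B : V →ₛₗ[σ] V →ₗ[K] K} {W : Submodule K V} {L M : Submodule 𝒪[K] V}

/-- `L ⊆ W`. [cite: Omeara1963, §81A] -/
theorem le_span (hL : IsUnimodularLattice B W L) {x : V} (hx : x ∈ L) : x ∈ W := by
  rw [← hL.span_eq]; exact Submodule.subset_span hx

/-- Two unimodular lattices in the same space, one inside the other, are equal. [cite: Omeara1963, §82F] -/
theorem eq_of_le (hL : IsUnimodularLattice B W L) (hM : IsUnimodularLattice B W M) (h : M ≤ L) :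
    M = L :=
  le_antisymm h fun z hz => hM.dual z (hL.le_span hz) fun x hx => hL.integral x (h hx) z hz

/-- Powers of a uniformiser: `v (ϖ ^ k) ≤ 1`. [cite: Omeara1963, Ch. I §16] -/
private theorem v_uniformizer_pow_le_one (hϖ : Valued.v ϖ = WithZero.exp (-1 : ℤ)) (k : ℕ) :
    Valued.v (ϖ ^ k) ≤ 1 := by
  rw [map_pow, hϖ, ← WithZero.exp_nsmul, ← WithZero.exp_zero, WithZero.exp_le_exp]
  simp

/-- Every element becomes integral after multiplication by a power of a uniformiser. [cite: Omeara1963, Ch. I §16] -/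
private theorem exists_uniformizer_pow_mul_le_one (hϖ : Valued.v ϖ = WithZero.exp (-1 : ℤ)) (c : K) :
    ∃ k : ℕ, Valued.v (ϖ ^ k * c) ≤ 1 := by
  by_cases hc : Valued.v c = 0
  · exact ⟨0, by rw [map_mul, hc, mul_zero]; exact zero_le⟩
  · obtain ⟨n, hn⟩ : ∃ n : ℤ, Valued.v c = WithZero.exp n := ⟨_, (WithZero.exp_log hc).symm⟩
    refine ⟨n.toNat, ?_⟩
    rw [map_mul, map_pow, hϖ, ← WithZero.exp_nsmul, hn, ← WithZero.exp_add, ← WithZero.exp_zero,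
      WithZero.exp_le_exp]
    simp only [nsmul_eq_mul, mul_neg, mul_one]
    omega

/-- Every vector of `W` has a `ϖ`-power multiple in `L`, for any uniformiser `ϖ`. [cite: Omeara1963, §81A] -/
theorem exists_pow_smul_mem' (hϖ : Valued.v ϖ = WithZero.exp (-1 : ℤ)) (hL : IsUnimodularLattice B W L) {z : V}
    (hz : z ∈ W) : ∃ k : ℕ, (ϖ ^ k) • z ∈ L := by
  rw [← hL.span_eq] at hz
  induction hz using Submodule.span_induction with
  | mem x hx => exact ⟨0, by simpa using hx⟩
  | zero => exact ⟨0, by simp⟩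
  | add x y _ _ ihx ihy =>
    obtain ⟨k, hk⟩ := ihx
    obtain ⟨l, hl⟩ := ihy
    refine ⟨k + l, ?_⟩
    rw [smul_add]
    refine L.add_mem ?_ ?_
    · rw [pow_add, mul_comm, mul_smul]
      exact smul_mem_of_v_le L (v_uniformizer_pow_le_one hϖ l) hk
    · rw [pow_add, mul_smul]
      exact smul_mem_of_v_le L (v_uniformizer_pow_le_one hϖ k) hl
  | smul a x _ ihx =>
    obtain ⟨k, hk⟩ := ihx
    obtain ⟨j, hj⟩ := exists_uniformizer_pow_mul_le_one hϖ a
    refine ⟨j + k, ?_⟩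
    rw [smul_smul, show ϖ ^ (j + k) * a = (ϖ ^ j * a) * ϖ ^ k by ring, mul_smul]
    exact smul_mem_of_v_le L hj hk

/-- Every vector of `W` has a `ϖ`-power multiple in `L`. [cite: Omeara1963, §81A] -/
theorem exists_pow_smul_mem (hd : LocalConjDatum σ ϖ) (hL : IsUnimodularLattice B W L) {z : V}
    (hz : z ∈ W) : ∃ k : ℕ, (ϖ ^ k) • z ∈ L :=
  hL.exists_pow_smul_mem' hd.vϖ hz

/-- **Commensurability** for any uniformiser: `ϖ ^ a • M ⊆ L` for some `a`. [cite: Omeara1963, §81] -/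
theorem exists_level' (hϖ : Valued.v ϖ = WithZero.exp (-1 : ℤ)) (hL : IsUnimodularLattice B W L)
    (hM : IsUnimodularLattice B W M) : ∃ a : ℕ, ∀ m ∈ M, (ϖ ^ a) • m ∈ L := by
  classical
  obtain ⟨S, hSfin, hSspan⟩ := Submodule.fg_def.1 hM.fg
  -- a uniform exponent on the finite generating set
  have hSW : ∀ s ∈ S, s ∈ W := fun s hs => hM.le_span (hSspan ▸ Submodule.subset_span hs)
  choose! k hk using fun s (hs : s ∈ S) => hL.exists_pow_smul_mem' hϖ (hSW s hs)
  refine ⟨hSfin.toFinset.sup k, ?_⟩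
  set a := hSfin.toFinset.sup k with ha
  -- the set of `m` with `ϖ^a m ∈ L` is an `𝒪`-submodule containing `S`
  let ϖa : 𝒪[K] := ⟨ϖ ^ a, (mem_integer_iff' _).2 (v_uniformizer_pow_le_one hϖ a)⟩
  let N : Submodule 𝒪[K] V := L.comap (DistribSMul.toLinearMap 𝒪[K] V ϖa)
  have hN : ∀ m, m ∈ N ↔ (ϖ ^ a) • m ∈ L := fun m => Iff.rfl
  have hSN : S ⊆ N := by
    intro s hs
    rw [SetLike.mem_coe, hN]
    have hks : k s ≤ a := Finset.le_sup (hSfin.mem_toFinset.2 hs)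
    obtain ⟨d, hd'⟩ := Nat.exists_eq_add_of_le hks
    rw [hd', pow_add, mul_comm, mul_smul]
    exact smul_mem_of_v_le L (v_uniformizer_pow_le_one hϖ d) (hk s hs)
  intro m hm
  rw [← hSspan] at hm
  exact (hN m).1 (Submodule.span_le.2 hSN hm)

/-- **Commensurability**: for two lattices in `W`, `ϖ ^ a • M ⊆ L` for some `a`. [cite: Omeara1963, §81] -/
theorem exists_level (hd : LocalConjDatum σ ϖ) (hL : IsUnimodularLattice B W L)
    (hM : IsUnimodularLattice B W M) : ∃ a : ℕ, ∀ m ∈ M, (ϖ ^ a) • m ∈ L :=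
  hL.exists_level' hd.vϖ hM

/-- **Primitive vectors have partners**, for any uniformiser `ϖ` and valuation-preserving `σ`: if `x ∈ L` is
primitive (`ϖ⁻¹ x ∉ L`) in the unimodular lattice `L`, there is `y ∈ L` with `B x y = 1` — otherwise
`B(x, L) ⊆ 𝔪 = ϖ𝒪` and `ϖ⁻¹ x ∈ L^# ∩ W = L`. [cite: Omeara1963, §82F (82:17)] -/
theorem exists_apply_eq_one_of_not_mem' (hϖ : Valued.v ϖ = WithZero.exp (-1 : ℤ))
    (hvσ : ∀ a, Valued.v (σ a) = Valued.v a) (hB : IsHermitianForm B)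
    (hL : IsUnimodularLattice B W L) {x : V} (hx : x ∈ L) (hprim : ϖ⁻¹ • x ∉ L) :
    ∃ y ∈ L, B x y = 1 := by
  by_contra H
  push Not at H
  have hlt : ∀ y ∈ L, Valued.v (B x y) < 1 := by
    intro y hy
    rcases (hL.integral x hx y hy).lt_or_eq with h | h
    · exact h
    · exfalso
      have hne : B x y ≠ 0 := fun h0 => by rw [h0, map_zero] at h; exact zero_ne_one h
      refine H ((B x y)⁻¹ • y) (smul_mem_of_v_le L (by rw [map_inv₀, h, inv_one]) hy) ?_
      rw [form_smul_right, inv_mul_cancel₀ hne]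
  refine hprim (hL.dual _ (W.smul_mem _ (hL.le_span hx)) fun y hy => ?_)
  rw [form_smul_right, map_mul, map_inv₀, hϖ, hB.v_comm hvσ x y]
  have h1 : Valued.v (B x y) ≤ WithZero.exp (-1 : ℤ) := (v_lt_one_iff _).1 (hlt y hy)
  calc (WithZero.exp (-1 : ℤ))⁻¹ * Valued.v (B x y)
      ≤ (WithZero.exp (-1 : ℤ))⁻¹ * WithZero.exp (-1 : ℤ) := mul_le_mul' le_rfl h1
    _ = 1 := inv_mul_cancel₀ WithZero.coe_ne_zero

/-- **Primitive vectors have partners.** If `x ∈ L` is primitive (`ϖ⁻¹ x ∉ L`) in the unimodular lattice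
`L`, there is `y ∈ L` with `B x y = 1`: otherwise `B(x, L) ⊆ 𝔪 = ϖ𝒪` and `ϖ⁻¹ x ∈ L^# ∩ W = L`.
[cite: Omeara1963, §82F (82:17)] -/
theorem exists_apply_eq_one_of_not_mem (hd : LocalConjDatum σ ϖ) (hB : IsHermitianForm B)
    (hL : IsUnimodularLattice B W L) {x : V} (hx : x ∈ L) (hprim : ϖ⁻¹ • x ∉ L) :
    ∃ y ∈ L, B x y = 1 :=
  hL.exists_apply_eq_one_of_not_mem' hd.vϖ hd.vσ hB hx hprim

/-- **The level of `M` relative to `L`**, for any uniformiser `ϖ`: if `M ⊄ L` there are `a ≥ 1` with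
`ϖ ^ a • M ⊆ L` and a vector `m ∈ M` with `ϖ ^ a • m ∈ L` primitive (`ϖ⁻¹ • ϖ ^ a • m ∉ L`): take `a` least.
[cite: Omeara1963, §81D] -/
theorem exists_primitive_of_not_le' (hϖ : Valued.v ϖ = WithZero.exp (-1 : ℤ)) (hL : IsUnimodularLattice B W L)
    (hM : IsUnimodularLattice B W M) (h : ¬ M ≤ L) :
    ∃ a : ℕ, 1 ≤ a ∧ (∀ m ∈ M, (ϖ ^ a) • m ∈ L) ∧ ∃ m ∈ M, ϖ⁻¹ • ((ϖ ^ a) • m) ∉ L := by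
  classical
  have hϖ0 : ϖ ≠ 0 := fun h0 => by
    rw [h0, map_zero] at hϖ
    exact WithZero.coe_ne_zero hϖ.symm
  have hex := hL.exists_level' hϖ hM
  have haspec : ∀ m ∈ M, (ϖ ^ Nat.find hex) • m ∈ L := Nat.find_spec hex
  have ha0 : Nat.find hex ≠ 0 := by
    intro h0
    apply h
    intro m hm
    have := haspec m hm
    rwa [h0, pow_zero, one_smul] at this
  obtain ⟨a', ha'⟩ : ∃ a', Nat.find hex = a' + 1 := ⟨Nat.find hex - 1, by omega⟩
  have hmin : ¬ ∀ m ∈ M, (ϖ ^ a') • m ∈ L := Nat.find_min hex (by omega)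
  push Not at hmin
  obtain ⟨m, hm, hm'⟩ := hmin
  rw [ha'] at haspec
  refine ⟨a' + 1, by omega, haspec, m, hm, ?_⟩
  have : ϖ⁻¹ * ϖ ^ (a' + 1) = ϖ ^ a' := by
    rw [pow_succ, mul_comm, mul_assoc, mul_inv_cancel₀ hϖ0, mul_one]
  rwa [smul_smul, this]

/-- **The level of `M` relative to `L`.** If `M ⊄ L` there are `a ≥ 1` with `ϖ ^ a • M ⊆ L` and a vector
`m ∈ M` with `ϖ ^ a • m ∈ L` primitive (`ϖ⁻¹ • ϖ ^ a • m ∉ L`): take `a` least. [cite: Omeara1963, §81D] -/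
theorem exists_primitive_of_not_le (hd : LocalConjDatum σ ϖ) (hL : IsUnimodularLattice B W L)
    (hM : IsUnimodularLattice B W M) (h : ¬ M ≤ L) :
    ∃ a : ℕ, 1 ≤ a ∧ (∀ m ∈ M, (ϖ ^ a) • m ∈ L) ∧ ∃ m ∈ M, ϖ⁻¹ • ((ϖ ^ a) • m) ∉ L :=
  hL.exists_primitive_of_not_le' hd.vϖ hM h

/-- **Transport along a bijective isometry** (in the whole space): if `φ : V ≃ₗ[K] V` preserves `B` and
`L` is unimodular in `⊤`, so is `φ(L)`. [cite: Omeara1963, §82F] -/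
theorem map_equiv (hL : IsUnimodularLattice B ⊤ L) (φ : V ≃ₗ[K] V)
    (hφ : ∀ u v, B (φ u) (φ v) = B u v) :
    IsUnimodularLattice B ⊤ (L.map (φ.toLinearMap.restrictScalars 𝒪[K])) := by
  refine ⟨hL.fg.map _, ?_, ?_, ?_⟩
  · apply eq_top_iff.2
    intro z _
    have hz : φ.symm z ∈ Submodule.span K (L : Set V) := by rw [hL.span_eq]; trivial
    have : φ (φ.symm z) ∈ (Submodule.span K (L : Set V)).map φ.toLinearMap :=
      Submodule.mem_map_of_mem hz
    rw [LinearEquiv.apply_symm_apply, Submodule.map_span] at this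
    refine Submodule.span_mono ?_ this
    rintro _ ⟨x, hx, rfl⟩
    exact ⟨x, hx, rfl⟩
  · rintro _ ⟨x, hx, rfl⟩ _ ⟨y, hy, rfl⟩
    simpa only [LinearMap.coe_restrictScalars, LinearEquiv.coe_coe, hφ] using hL.integral x hx y hy
  · intro z _ hz
    have hz' : φ.symm z ∈ L := by
      refine hL.dual _ trivial fun x hx => ?_
      have := hz (φ x) ⟨x, hx, rfl⟩
      rwa [← hφ x (φ.symm z), LinearEquiv.apply_symm_apply]
    exact ⟨φ.symm z, hz', by simp⟩

end IsUnimodularLattice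

end Lattice

end Literature.NumberTheory.Automorphic.HermitianLattice

end
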